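import Literature.MathematicalPhysics.QuantumLattice.SU2Haar
import Mathlib.MeasureTheory.Measure.Haar.NormedSpace
import Mathlib.Analysis.SpecialFunctions.Integrals.Basic
import HarnessLib

/-!
# Haar measure on `SU(2)` in the gnomonic chart

Sibling of `SU2Haar.lean` (Haar on `SU(2)` as the cone measure of the unit quaternion ball,
`lintegral_haarProbability_su2`): the explicit density of Haar measure in a chart at the identity.
Main result (`lintegral_haarProbability_su2_gnomonic`): for measurable `F ≥ 0` on
`SU(2) = Matrix.specialUnitaryGroup (Fin 2) ℂ`,

  `∫ F dHaar = (2π²)⁻¹ ∫_{ℝ³} [F(P(1, v)) + F(P(−(1, v)))] (1 + |v|²)⁻² dv`,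

`P = quatToSU2` the radial projection `ℍ ∖ {0} → S³ ≅ SU(2)`, `(1, v) = gnomonicQuat v`: the two
open hemispheres `re ≷ 0` of `S³`, in the gnomonic coordinate `v = im x / re x ∈ ℝ³`, carry the
density `(2π²)⁻¹ (1 + |v|²)⁻²` (total mass `½` each, `∫_{ℝ³} (1+|v|²)⁻² dv = π²`). This is the
coordinate form of "normalised Haar on `SU(2)` = uniform measure on `S³`" which Chatterjee
(Probab. Math. Phys. 7 (2026) 339, arXiv:2401.10507, Lemma 5.1 / Cor. 5.2) uses through the
stereographic chart (density `∝ (4 + |x|²)⁻³`); the gnomonic chart is the one adapted to the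
Gaussian approximation of the Boltzmann weights at the identity (DAG node N1/N2 of the S19 plan in
`ContinuumLimits.lean`). All statements are proved; the only definitions are the coordinate
equivalence `quatReImEquiv : ℍ ≃ᵐ ℝ × ℝ³`, `gnomonicQuat`, and the equatorial submodule.

## Proof

* `setLIntegral_pos_re_ball_eq`: for a scale-invariant measurable `G` (e.g. `F ∘ P`),
  `∫_{re>0, ‖x‖<1} G = ¼ ∫ G(1, v)(1+|v|²)⁻² dv` — transport along the volume-preserving
  `quatReImEquiv` (`linearIsometryEquivTuple`, `EuclideanSpace.volume_preserving_symm_measurableEquiv_toLp`,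
  `volume_preserving_piFinSuccAbove`), Tonelli on `ℝ × ℝ³`, the linear substitution `y = t v` in
  `ℝ³` (`Measure.map_addHaar_smul`: `∫ H(y) dy = t³ ∫ H(tv) dv`), Tonelli again, and
  `∫₀^{(1+|v|²)^{-1/2}} t³ dt = (1+|v|²)⁻²/4` (`integral_pow`).
* `setLIntegral_neg_re_ball_eq`: the lower hemisphere is the upper one composed with `x ↦ −x`, the
  volume-preserving left multiplication by the unit quaternion `−1` (`Tao2016.quatLmul`), and
  `P(−x) = P(−1) P(x)` (`quatToSU2_neg`); `setLIntegral_ball_eq_add`: the equator `{re = 0}` is a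
  proper submodule, hence null (`Measure.addHaar_submodule`).
* Assembly with `vol(B⁴) = π²/2` (`volume_ball_quat`).
-/

open MeasureTheory Quaternion Filter Topology Set
open scoped Quaternion ENNReal

noncomputable section

namespace Literature.MathematicalPhysics.QuantumLattice

/-- `SU(2)` as Mathlib's `Matrix.specialUnitaryGroup (Fin 2) ℂ` (file-local notation, as in
`SU2Haar.lean`). -/
local notation "SU2" => Matrix.specialUnitaryGroup (Fin 2) ℂ

attribute [local instance] Literature.Analysis.FluidPDE.Tao2016.quatMeasurableSpace
  Literature.Analysis.FluidPDE.Tao2016.quatBorelSpace secondCountableTopology_su2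

/-! ### Scale invariance and the antipodal map -/

/-- The radial projection is scale invariant: `quatToSU2 (t • x) = quatToSU2 x` for `t > 0`.
[folklore] -/
theorem quatToSU2_smul {t : ℝ} (ht : 0 < t) (x : ℍ) : quatToSU2 (t • x) = quatToSU2 x := by
  by_cases hx : x = 0
  · subst hx; simp
  have htx : t • x ≠ 0 := smul_ne_zero ht.ne' hx
  apply Subtype.ext
  rw [coe_quatToSU2 htx, coe_quatToSU2 hx, norm_smul, Real.norm_of_nonneg ht.le, mul_inv,
    smul_smul]
  congr 2
  field_simp

/-- The antipodal map on `S³` is left multiplication by `-1 ∈ SU(2)`: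
`quatToSU2 (-x) = quatToSU2 (-1) * quatToSU2 x` (`x ≠ 0`). [folklore] -/
theorem quatToSU2_neg {x : ℍ} (hx : x ≠ 0) : quatToSU2 (-x) = quatToSU2 (-1 : ℍ) * quatToSU2 x := by
  have h1 : (-1 : ℍ) ≠ 0 := neg_ne_zero.2 one_ne_zero
  apply Subtype.ext
  rw [Submonoid.coe_mul, coe_quatToSU2 (neg_ne_zero.2 hx), coe_quatToSU2 h1, coe_quatToSU2 hx,
    ← quatMatrix_mul, norm_neg, norm_neg, norm_one, inv_one, one_smul, smul_neg, neg_one_mul]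

/-! ### Coordinates `ℍ ≃ ℝ × ℝ³` -/

/-- Real part and imaginary vector of a quaternion, as a measurable equivalence
`ℍ ≃ᵐ ℝ × (Fin 3 → ℝ)`. [folklore] -/
def quatReImEquiv : ℍ ≃ᵐ ℝ × (Fin 3 → ℝ) :=
  linearIsometryEquivTuple.toHomeomorph.toMeasurableEquiv.trans
    ((MeasurableEquiv.toLp 2 (Fin 4 → ℝ)).symm.trans (MeasurableEquiv.piFinSuccAbove (fun _ => ℝ) 0))

/-- `quatReImEquiv q = (re q, (imI q, imJ q, imK q))`. [folklore] -/
theorem quatReImEquiv_apply (q : ℍ) : quatReImEquiv q = (q.re, ![q.imI, q.imJ, q.imK]) := by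
  refine Prod.ext rfl ?_
  funext i
  fin_cases i <;> rfl

/-- The inverse: `quatReImEquiv.symm (t, v) = ⟨t, v 0, v 1, v 2⟩`. [folklore] -/
theorem quatReImEquiv_symm_apply (t : ℝ) (v : Fin 3 → ℝ) :
    quatReImEquiv.symm (t, v) = (⟨t, v 0, v 1, v 2⟩ : ℍ) := by
  apply quatReImEquiv.injective
  rw [MeasurableEquiv.apply_symm_apply, quatReImEquiv_apply]
  refine Prod.ext rfl ?_
  funext i
  fin_cases i <;> rfl

/-- `quatReImEquiv` carries Lebesgue measure on `ℍ ≅ ℝ⁴` to the product Lebesgue measure. [folklore] -/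
theorem measurePreserving_quatReImEquiv : MeasurePreserving quatReImEquiv volume volume :=
  (linearIsometryEquivTuple.measurePreserving).trans
    ((EuclideanSpace.volume_preserving_symm_measurableEquiv_toLp (Fin 4)).trans
      (volume_preserving_piFinSuccAbove (fun _ : Fin 4 => ℝ) 0))

/-! ### Two elementary integrals -/

/-- Linear scaling of Lebesgue measure on `ℝ³`: `∫ H(y) dy = t³ ∫ H(t v) dv` for `t > 0`. [folklore] -/
theorem lintegral_eq_pow_mul_lintegral_smul (H : (Fin 3 → ℝ) → ℝ≥0∞) {t : ℝ} (ht : 0 < t) :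
    ∫⁻ y, H y = ENNReal.ofReal (t ^ 3) * ∫⁻ v, H (t • v) := by
  have hmap := Measure.map_addHaar_smul (volume : Measure (Fin 3 → ℝ)) ht.ne'
  rw [Module.finrank_fintype_fun_eq_card, Fintype.card_fin] at hmap
  have h1 : ∫⁻ v, H (t • v) = ∫⁻ y, H y ∂(Measure.map (fun v : Fin 3 → ℝ => t • v) volume) :=
    (lintegral_map_equiv H (Homeomorph.smulOfNeZero t ht.ne').toMeasurableEquiv).symm
  rw [h1, hmap, lintegral_smul_measure, smul_eq_mul, ← mul_assoc, ← ENNReal.ofReal_mul (by positivity),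
    abs_of_pos (by positivity), mul_inv_cancel₀ (by positivity), ENNReal.ofReal_one, one_mul]

/-- `∫_{0<t<r} t³ dt = r⁴/4` as a lower Lebesgue integral (`r ≥ 0`). [folklore] -/
theorem lintegral_Ioo_pow_three {r : ℝ} (hr : 0 ≤ r) :
    ∫⁻ t in Ioo 0 r, ENNReal.ofReal (t ^ 3) = ENNReal.ofReal (r ^ 4 / 4) := by
  have hint : IntegrableOn (fun t : ℝ => t ^ 3) (Ioo 0 r) :=
    ((continuous_pow 3).integrableOn_Icc).mono_set Ioo_subset_Icc_self
  rw [← ofReal_integral_eq_lintegral_ofReal hint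
    (ae_restrict_of_forall_mem measurableSet_Ioo fun t ht => by positivity [ht.1.le])]
  congr 1
  rw [← integral_Ioc_eq_integral_Ioo, ← intervalIntegral.integral_of_le hr, integral_pow]
  ring

/-! ### The gnomonic chart: the upper hemisphere -/

/-- The quaternion `(1, v)` of gnomonic coordinate `v ∈ ℝ³` (its radial projection is the point of
the open upper hemisphere `re > 0` of `S³` with gnomonic coordinate `v`). [folklore] -/
def gnomonicQuat (v : Fin 3 → ℝ) : ℍ := ⟨1, v 0, v 1, v 2⟩

/-- `gnomonicQuat v = quatReImEquiv.symm (1, v)`. [folklore] -/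
theorem gnomonicQuat_eq (v : Fin 3 → ℝ) : gnomonicQuat v = quatReImEquiv.symm (1, v) := by
  rw [quatReImEquiv_symm_apply]; rfl

/-- `gnomonicQuat` is measurable. [folklore] -/
theorem measurable_gnomonicQuat : Measurable gnomonicQuat := by
  have h : gnomonicQuat = fun v => quatReImEquiv.symm (1, v) := funext gnomonicQuat_eq
  rw [h]
  exact quatReImEquiv.symm.measurable.comp (measurable_const.prodMk measurable_id)

/-- `‖(1, v)‖² = 1 + ∑ vᵢ²`. [folklore] -/
theorem sq_norm_gnomonicQuat (v : Fin 3 → ℝ) : ‖gnomonicQuat v‖ ^ 2 = 1 + ∑ i, v i ^ 2 := by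
  rw [show ‖gnomonicQuat v‖ ^ 2 = ‖gnomonicQuat v‖ * ‖gnomonicQuat v‖ from sq _,
    ← Quaternion.normSq_eq_norm_mul_self, Quaternion.normSq_def', Fin.sum_univ_three]
  simp [gnomonicQuat]
  ring

/-- `‖(1, v)‖ ≥ 1 > 0`. [folklore] -/
theorem norm_gnomonicQuat_pos (v : Fin 3 → ℝ) : 0 < ‖gnomonicQuat v‖ := by
  have h := sq_norm_gnomonicQuat v
  have hs : 0 ≤ ∑ i, v i ^ 2 := Finset.sum_nonneg fun i _ => sq_nonneg _
  nlinarith [norm_nonneg (gnomonicQuat v)]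

/-- Scaling the gnomonic quaternion: `quatReImEquiv.symm (t, t • v) = t • (1, v)`. [folklore] -/
theorem quatReImEquiv_symm_smul (t : ℝ) (v : Fin 3 → ℝ) :
    quatReImEquiv.symm (t, t • v) = t • gnomonicQuat v := by
  rw [quatReImEquiv_symm_apply, gnomonicQuat]
  ext <;> simp

/-- The real part of `quatReImEquiv.symm (t, y)` is `t`. [folklore] -/
theorem re_quatReImEquiv_symm (t : ℝ) (y : Fin 3 → ℝ) : (quatReImEquiv.symm (t, y)).re = t := by
  rw [quatReImEquiv_symm_apply]

/-- **Haar integral over the upper hemisphere in gnomonic coordinates** (cone form): for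
measurable `G : ℍ → [0,∞]` which is invariant under positive scaling (e.g. `G = F ∘ quatToSU2`),
`∫_{re x > 0, ‖x‖ < 1} G(x) dx = ¼ ∫_{ℝ³} G(1, v) (1 + |v|²)⁻² dv`.
Fubini over `ℝ × ℝ³`, the substitution `y = t v` in the imaginary part, and
`∫₀^{(1+|v|²)^{-1/2}} t³ dt = (1+|v|²)⁻²/4`. [folklore] -/
theorem setLIntegral_pos_re_ball_eq (G : ℍ → ℝ≥0∞) (hG : Measurable G)
    (hscale : ∀ (t : ℝ), 0 < t → ∀ x, G (t • x) = G x) :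
    ∫⁻ x in {x : ℍ | 0 < x.re} ∩ Metric.ball 0 1, G x =
      ∫⁻ v : Fin 3 → ℝ, G (gnomonicQuat v) * ENNReal.ofReal (((1 + ∑ i, v i ^ 2)⁻¹) ^ 2 / 4) := by
  set e := quatReImEquiv with he
  set A : Set ℍ := {x : ℍ | 0 < x.re} ∩ Metric.ball 0 1 with hA
  have hAm : MeasurableSet A :=
    (measurableSet_lt measurable_const Quaternion.continuous_re.measurable).inter measurableSet_ball
  -- Step 1: transport to `ℝ × ℝ³`
  have hΨm : Measurable fun p : ℝ × (Fin 3 → ℝ) => A.indicator G (e.symm p) :=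
    (hG.indicator hAm).comp e.symm.measurable
  have h1 : ∫⁻ x in A, G x = ∫⁻ p : ℝ × (Fin 3 → ℝ), A.indicator G (e.symm p) := by
    rw [← lintegral_indicator hAm]
    exact ((measurePreserving_quatReImEquiv.symm e).lintegral_comp_emb
      e.symm.measurableEmbedding (A.indicator G)).symm
  -- Step 2: Tonelli
  have h2 : ∫⁻ p : ℝ × (Fin 3 → ℝ), A.indicator G (e.symm p) =
      ∫⁻ t : ℝ, ∫⁻ y : Fin 3 → ℝ, A.indicator G (e.symm (t, y)) := by
    rw [Measure.volume_eq_prod]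
    exact lintegral_prod _ hΨm.aemeasurable
  -- the inner integrand vanishes for `t ≤ 0`
  have hzero : ∀ t : ℝ, t ≤ 0 → ∀ y : Fin 3 → ℝ, A.indicator G (e.symm (t, y)) = 0 := by
    intro t ht y
    refine Set.indicator_of_notMem ?_ _
    rintro ⟨hre, -⟩
    rw [Set.mem_setOf_eq, he, re_quatReImEquiv_symm] at hre
    exact absurd hre (not_lt.2 ht)
  -- the integrand in scaled coordinates: for `t > 0`,
  -- `1_A(e⁻¹(t, t v)) G(e⁻¹(t, t v)) = 1_{t ‖(1,v)‖ < 1} G(1, v)`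
  set K : ℝ → (Fin 3 → ℝ) → ℝ≥0∞ := fun t v =>
    if t * ‖gnomonicQuat v‖ < 1 then G (gnomonicQuat v) else 0 with hK
  have hKm : Measurable (Function.uncurry K) := by
    refine Measurable.ite ?_ (hG.comp (measurable_gnomonicQuat.comp measurable_snd)) measurable_const
    exact measurableSet_lt (measurable_fst.mul
      ((continuous_norm.measurable.comp measurable_gnomonicQuat).comp measurable_snd)) measurable_const
  have hscaled : ∀ t : ℝ, 0 < t → ∀ v : Fin 3 → ℝ,
      A.indicator G (e.symm (t, t • v)) = K t v := by
    intro t ht v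
    rw [he, quatReImEquiv_symm_smul]
    by_cases hlt : t * ‖gnomonicQuat v‖ < 1
    · rw [hK]; simp only [hlt, if_true]
      rw [Set.indicator_of_mem, hscale t ht]
      refine ⟨?_, ?_⟩
      · show 0 < (t • gnomonicQuat v).re
        rw [Quaternion.re_smul, gnomonicQuat, smul_eq_mul, mul_one]; exact ht
      · rw [Metric.mem_ball, dist_zero_right, norm_smul, Real.norm_of_nonneg ht.le]; exact hlt
    · rw [hK]; simp only [hlt, if_false]
      refine Set.indicator_of_notMem ?_ _
      rintro ⟨-, hball⟩
      rw [Metric.mem_ball, dist_zero_right, norm_smul, Real.norm_of_nonneg ht.le] at hball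
      exact hlt hball
  -- Step 3: inner integral for `t > 0` by scaling
  have h3 : ∀ t : ℝ, 0 < t →
      ∫⁻ y : Fin 3 → ℝ, A.indicator G (e.symm (t, y)) = ENNReal.ofReal (t ^ 3) * ∫⁻ v, K t v := by
    intro t ht
    rw [lintegral_eq_pow_mul_lintegral_smul _ ht]
    congr 1
    exact lintegral_congr fun v => hscaled t ht v
  -- Step 4: assemble the `t`-integral as a set integral over `t > 0`
  have h4 : ∫⁻ t : ℝ, ∫⁻ y : Fin 3 → ℝ, A.indicator G (e.symm (t, y)) =
      ∫⁻ t in Ioi (0 : ℝ), ENNReal.ofReal (t ^ 3) * ∫⁻ v, K t v := by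
    rw [← lintegral_indicator measurableSet_Ioi]
    refine lintegral_congr fun t => ?_
    by_cases ht : 0 < t
    · rw [Set.indicator_of_mem (Set.mem_Ioi.2 ht), h3 t ht]
    · rw [Set.indicator_of_notMem (fun h => ht (Set.mem_Ioi.1 h))]
      simp only [hzero t (not_lt.1 ht), lintegral_const, zero_mul]
  -- Step 5: swap the order of integration
  have h5 : ∫⁻ t in Ioi (0 : ℝ), ENNReal.ofReal (t ^ 3) * ∫⁻ v, K t v =
      ∫⁻ v : Fin 3 → ℝ, ∫⁻ t in Ioi (0 : ℝ), ENNReal.ofReal (t ^ 3) * K t v := by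
    have hm : AEMeasurable (Function.uncurry fun (t : ℝ) (v : Fin 3 → ℝ) =>
        ENNReal.ofReal (t ^ 3) * K t v) ((volume.restrict (Ioi (0 : ℝ))).prod volume) :=
      ((ENNReal.measurable_ofReal.comp ((measurable_fst (α := ℝ) (β := Fin 3 → ℝ)).pow_const 3)).mul
        hKm).aemeasurable
    rw [← lintegral_lintegral_swap hm]
    refine lintegral_congr fun t => ?_
    rw [lintegral_const_mul' _ _ ENNReal.ofReal_ne_top]
  -- Step 6: the `t`-integral for fixed `v`
  have h6 : ∀ v : Fin 3 → ℝ, ∫⁻ t in Ioi (0 : ℝ), ENNReal.ofReal (t ^ 3) * K t v =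
      G (gnomonicQuat v) * ENNReal.ofReal (((1 + ∑ i, v i ^ 2)⁻¹) ^ 2 / 4) := by
    intro v
    set r := ‖gnomonicQuat v‖ with hr
    have hr0 : 0 < r := norm_gnomonicQuat_pos v
    have hiff : ∀ t : ℝ, t * r < 1 ↔ t < r⁻¹ := fun t => by
      rw [← one_mul r⁻¹, lt_mul_inv_iff₀ hr0]
    have hind : ∀ t : ℝ, ENNReal.ofReal (t ^ 3) * K t v =
        (Iio r⁻¹).indicator (fun t => ENNReal.ofReal (t ^ 3) * G (gnomonicQuat v)) t := by
      intro t
      simp only [hK, ← hr, hiff, Set.indicator_apply, Set.mem_Iio, mul_ite, mul_zero]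
    have hr4 : r⁻¹ ^ 4 / 4 = ((1 + ∑ i, v i ^ 2)⁻¹) ^ 2 / 4 := by
      rw [← sq_norm_gnomonicQuat, ← hr, inv_pow, inv_pow, ← pow_mul]
    calc ∫⁻ t in Ioi (0 : ℝ), ENNReal.ofReal (t ^ 3) * K t v
        = ∫⁻ t in Ioi (0 : ℝ), (Iio r⁻¹).indicator
            (fun t => ENNReal.ofReal (t ^ 3) * G (gnomonicQuat v)) t := lintegral_congr hind
      _ = ∫⁻ t in Ioo (0 : ℝ) r⁻¹, ENNReal.ofReal (t ^ 3) * G (gnomonicQuat v) := by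
          rw [lintegral_indicator measurableSet_Iio, Measure.restrict_restrict measurableSet_Iio,
            Set.Iio_inter_Ioi]
      _ = (∫⁻ t in Ioo (0 : ℝ) r⁻¹, ENNReal.ofReal (t ^ 3)) * G (gnomonicQuat v) :=
          lintegral_mul_const _ (ENNReal.measurable_ofReal.comp (measurable_id.pow_const 3))
      _ = G (gnomonicQuat v) * ENNReal.ofReal (((1 + ∑ i, v i ^ 2)⁻¹) ^ 2 / 4) := by
          rw [lintegral_Ioo_pow_three (inv_nonneg.2 hr0.le), hr4, mul_comm]
  -- Step 7: assemble
  rw [h1, h2, h4, h5]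
  exact lintegral_congr h6
/-! ### The lower hemisphere and the equator -/

/-- The purely imaginary quaternions, as a real submodule (the equatorial hyperplane `re = 0`).
[folklore] -/
def imQuatSubmodule : Submodule ℝ ℍ where
  carrier := {x : ℍ | x.re = 0}
  add_mem' := by
    intro a b ha hb
    simp only [Set.mem_setOf_eq] at ha hb ⊢
    rw [Quaternion.re_add, ha, hb, add_zero]
  zero_mem' := by simp
  smul_mem' := by
    intro c x hx
    simp only [Set.mem_setOf_eq] at hx ⊢
    rw [Quaternion.re_smul, hx, smul_zero]

/-- The equator `{re = 0}` is Lebesgue-null in `ℍ`. [folklore] -/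
theorem volume_re_eq_zero : (volume : Measure ℍ) {x : ℍ | x.re = 0} = 0 := by
  have h : (imQuatSubmodule : Set ℍ) = {x : ℍ | x.re = 0} := rfl
  rw [← h]
  refine Measure.addHaar_submodule volume imQuatSubmodule ?_
  intro htop
  have h1 : (1 : ℍ) ∈ imQuatSubmodule := htop ▸ Submodule.mem_top
  have h2 : (1 : ℍ).re = 0 := h1
  simp at h2

/-- **Lower hemisphere by the antipodal map**: `∫_{re<0, ‖x‖<1} G(x) dx = ∫_{re>0, ‖x‖<1} G(-x) dx`
(`x ↦ -x` is the volume-preserving left multiplication by the unit quaternion `-1`). [folklore] -/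
theorem setLIntegral_neg_re_ball_eq (G : ℍ → ℝ≥0∞) :
    ∫⁻ x in {x : ℍ | x.re < 0} ∩ Metric.ball 0 1, G x =
      ∫⁻ x in {x : ℍ | 0 < x.re} ∩ Metric.ball 0 1, G (-x) := by
  have hn1 : ‖(-1 : ℍ)‖ = 1 := by rw [norm_neg, norm_one]
  set n := (Literature.Analysis.FluidPDE.Tao2016.quatLmul (-1) hn1).toHomeomorph.toMeasurableEquiv
    with hn
  have hnapp : ∀ x : ℍ, n x = -x := fun x => by
    show (-1 : ℍ) * x = -x
    rw [neg_one_mul]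
  have hpres : MeasurePreserving n volume volume :=
    (Literature.Analysis.FluidPDE.Tao2016.quatLmul (-1) hn1).measurePreserving
  have hpre : n ⁻¹' ({x : ℍ | x.re < 0} ∩ Metric.ball 0 1) = {x : ℍ | 0 < x.re} ∩ Metric.ball 0 1 := by
    ext x
    simp only [Set.mem_preimage, Set.mem_inter_iff, Set.mem_setOf_eq, Metric.mem_ball, dist_zero_right,
      hnapp, Quaternion.re_neg, neg_lt_zero, norm_neg]
  rw [← hpres.setLIntegral_comp_preimage_emb n.measurableEmbedding G _, hpre]
  exact setLIntegral_congr_fun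
    ((measurableSet_lt measurable_const Quaternion.continuous_re.measurable).inter measurableSet_ball)
    (fun x _ => by simp only [hnapp])

/-- **Splitting the unit ball along the equator**: the integral over the ball is the sum of the
integrals over the two open hemispherical cones (the equator is null). [folklore] -/
theorem setLIntegral_ball_eq_add (G : ℍ → ℝ≥0∞) :
    ∫⁻ x in Metric.ball (0 : ℍ) 1, G x =
      (∫⁻ x in {x : ℍ | 0 < x.re} ∩ Metric.ball 0 1, G x) +
        ∫⁻ x in {x : ℍ | x.re < 0} ∩ Metric.ball 0 1, G x := by
  have hmre : Measurable fun x : ℍ => x.re := Quaternion.continuous_re.measurable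
  have hpos : MeasurableSet ({x : ℍ | 0 < x.re} ∩ Metric.ball 0 1) :=
    (measurableSet_lt measurable_const hmre).inter measurableSet_ball
  have hneg : MeasurableSet ({x : ℍ | x.re < 0} ∩ Metric.ball 0 1) :=
    (measurableSet_lt hmre measurable_const).inter measurableSet_ball
  -- remove the null equator
  have hae : (Metric.ball (0 : ℍ) 1 : Set ℍ) =ᵐ[volume]
      (Metric.ball (0 : ℍ) 1 ∩ {x : ℍ | x.re ≠ 0} : Set ℍ) := by
    have h1 : ({x : ℍ | x.re ≠ 0} : Set ℍ) =ᵐ[volume] (Set.univ : Set ℍ) := by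
      rw [ae_eq_univ]
      convert volume_re_eq_zero using 2
      ext x; simp
    simpa using (ae_eq_refl (Metric.ball (0 : ℍ) 1)).inter h1.symm
  rw [setLIntegral_congr hae]
  have hsplit : Metric.ball (0 : ℍ) 1 ∩ {x : ℍ | x.re ≠ 0} =
      ({x : ℍ | 0 < x.re} ∩ Metric.ball 0 1) ∪ ({x : ℍ | x.re < 0} ∩ Metric.ball 0 1) := by
    ext x
    simp only [Set.mem_inter_iff, Metric.mem_ball, Set.mem_setOf_eq, Set.mem_union, ne_eq]
    constructor
    · rintro ⟨hb, hre⟩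
      rcases lt_or_gt_of_ne hre with h | h
      · exact Or.inr ⟨h, hb⟩
      · exact Or.inl ⟨h, hb⟩
    · rintro (⟨h, hb⟩ | ⟨h, hb⟩)
      · exact ⟨hb, h.ne'⟩
      · exact ⟨hb, h.ne⟩
  rw [hsplit]
  refine lintegral_union hneg ?_
  rw [Set.disjoint_left]
  rintro x ⟨h1, -⟩ ⟨h2, -⟩
  simp only [Set.mem_setOf_eq] at h1 h2
  linarith

/-! ### The integration formula -/

/-- `gnomonicQuat v ≠ 0`. [folklore] -/
theorem gnomonicQuat_ne_zero (v : Fin 3 → ℝ) : gnomonicQuat v ≠ 0 := fun h => by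
  have := norm_gnomonicQuat_pos v
  rw [h, norm_zero] at this
  exact lt_irrefl _ this

/-- **Haar measure on `SU(2)` in the gnomonic chart.** For measurable `F ≥ 0` on `SU(2)`,

  `∫ F dHaar = (2π²)⁻¹ ∫_{ℝ³} [F(P(1, v)) + F(P(-1, -v))] (1 + |v|²)⁻² dv`,

where `P = quatToSU2` is the radial projection of `ℍ ∖ {0}` onto `S³ ≅ SU(2)` and
`(±1, ±v) = ±gnomonicQuat v`: the two hemispheres `re ≷ 0` in gnomonic coordinates `v = im x / re x`
carry the density `(1 + |v|²)⁻²` (the cone over `dv` at height `re = 1` meets the unit ball in the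
segment `0 < t < (1 + |v|²)^{-1/2}` of `t³ dt`-mass `(1+|v|²)⁻²/4`, and `vol(B⁴) = π²/2`). This is
the coordinate form of "Haar on `SU(2)` = uniform measure on `S³`" (Chatterjee, arXiv:2401.10507,
Lemma 5.1 / Cor. 5.2 use the stereographic chart with density `∝ (4 + |x|²)⁻³` instead; the
gnomonic chart is the one adapted to Gaussian approximation at the identity).
[cite: Chatterjee2026YMHiggs, Lemma 5.1 and Cor. 5.2 (Haar on SU(2) in coordinates)] -/
theorem lintegral_haarProbability_su2_gnomonic (F : SU2 → ℝ≥0∞) (hF : Measurable F) :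
    ∫⁻ U, F U ∂(QuantumFieldTheory.haarProbability SU2) =
      ENNReal.ofReal (1 / (2 * Real.pi ^ 2)) *
        ∫⁻ v : Fin 3 → ℝ, (F (quatToSU2 (gnomonicQuat v)) + F (quatToSU2 (-gnomonicQuat v))) *
          ENNReal.ofReal (((1 + ∑ i, v i ^ 2)⁻¹) ^ 2) := by
  -- the two hemispheres
  have hG1 : Measurable fun x : ℍ => F (quatToSU2 x) := hF.comp measurable_quatToSU2
  have hG2 : Measurable fun x : ℍ => F (quatToSU2 (-1 : ℍ) * quatToSU2 x) :=
    hF.comp ((continuous_const_mul _).measurable.comp measurable_quatToSU2)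
  have hs1 : ∀ t : ℝ, 0 < t → ∀ x : ℍ, F (quatToSU2 (t • x)) = F (quatToSU2 x) :=
    fun t ht x => by rw [quatToSU2_smul ht]
  have hs2 : ∀ t : ℝ, 0 < t → ∀ x : ℍ,
      F (quatToSU2 (-1 : ℍ) * quatToSU2 (t • x)) = F (quatToSU2 (-1 : ℍ) * quatToSU2 x) :=
    fun t ht x => by rw [quatToSU2_smul ht]
  have hU := setLIntegral_pos_re_ball_eq _ hG1 hs1
  have hL0 := setLIntegral_neg_re_ball_eq (fun x : ℍ => F (quatToSU2 x))
  -- on `re > 0`, `F(P(-x)) = F(P(-1) P(x))`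
  have hL1 : ∫⁻ x in {x : ℍ | 0 < x.re} ∩ Metric.ball 0 1, F (quatToSU2 (-x)) =
      ∫⁻ x in {x : ℍ | 0 < x.re} ∩ Metric.ball 0 1, F (quatToSU2 (-1 : ℍ) * quatToSU2 x) := by
    refine setLIntegral_congr_fun
      ((measurableSet_lt measurable_const Quaternion.continuous_re.measurable).inter measurableSet_ball)
      (fun x hx => ?_)
    have hx0 : x ≠ 0 := by
      rintro rfl
      exact absurd hx.1 (by simp)
    simp only [quatToSU2_neg hx0]
  have hL := setLIntegral_pos_re_ball_eq _ hG2 hs2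
  -- inside the `v`-integral, `P(-1) P(1,v) = P(-(1,v))`
  have hneg : ∀ v : Fin 3 → ℝ, quatToSU2 (-1 : ℍ) * quatToSU2 (gnomonicQuat v) =
      quatToSU2 (-gnomonicQuat v) := fun v => (quatToSU2_neg (gnomonicQuat_ne_zero v)).symm
  rw [lintegral_haarProbability_su2 F hF, setLIntegral_ball_eq_add, hU, hL0, hL1, hL, volume_ball_quat]
  -- constants: `(π²/2)⁻¹ · ¼ = (2π²)⁻¹`
  have hw : ∀ v : Fin 3 → ℝ, ENNReal.ofReal (((1 + ∑ i, v i ^ 2)⁻¹) ^ 2 / 4) =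
      ENNReal.ofReal (((1 + ∑ i, v i ^ 2)⁻¹) ^ 2) * ENNReal.ofReal (1 / 4) := fun v => by
    rw [← ENNReal.ofReal_mul (sq_nonneg _)]; ring_nf
  have hmeas1 : Measurable fun v : Fin 3 → ℝ =>
      F (quatToSU2 (gnomonicQuat v)) * ENNReal.ofReal (((1 + ∑ i, v i ^ 2)⁻¹) ^ 2 / 4) :=
    (hF.comp (measurable_quatToSU2.comp measurable_gnomonicQuat)).mul
      (ENNReal.measurable_ofReal.comp (by fun_prop))
  set J := ∫⁻ v : Fin 3 → ℝ, (F (quatToSU2 (gnomonicQuat v)) + F (quatToSU2 (-gnomonicQuat v))) *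
    ENNReal.ofReal (((1 + ∑ i, v i ^ 2)⁻¹) ^ 2) with hJ
  have hI : (∫⁻ v : Fin 3 → ℝ, F (quatToSU2 (gnomonicQuat v)) *
        ENNReal.ofReal (((1 + ∑ i, v i ^ 2)⁻¹) ^ 2 / 4)) +
      (∫⁻ v : Fin 3 → ℝ, F (quatToSU2 (-1 : ℍ) * quatToSU2 (gnomonicQuat v)) *
        ENNReal.ofReal (((1 + ∑ i, v i ^ 2)⁻¹) ^ 2 / 4)) = J * ENNReal.ofReal (1 / 4) := by
    rw [← lintegral_add_left hmeas1, hJ, ← lintegral_mul_const' _ _ ENNReal.ofReal_ne_top]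
    refine lintegral_congr fun v => ?_
    rw [hneg v, hw v]
    ring
  rw [hI, ← ENNReal.ofReal_inv_of_pos (by positivity), mul_comm J, ← mul_assoc,
    ← ENNReal.ofReal_mul (by positivity)]
  congr 1
  congr 1
  field_simp
  norm_num

end Literature.MathematicalPhysics.QuantumLattice
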